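import Summits.ResolutionOfSingularities.ResolutionOfSingularities.Theorems.HilbertSamuelEliminationSigmaMaxModificationsCorridor3WLadderStrataCentreDispatch
import Summits.ResolutionOfSingularities.ResolutionOfSingularities.Theorems.HilbertSamuelEliminationSigmaMaxModificationsCorridor3WLadderStrataCentreCurveCase
import Summits.ResolutionOfSingularities.ResolutionOfSingularities.Theorems.HilbertSamuelEliminationSigmaMaxModificationsCorridor3WLadderStrataCentreCurveGerm
import Summits.ResolutionOfSingularities.ResolutionOfSingularities.Theorems.HilbertSamuelEliminationSigmaMaxModificationsCorridor3WLadderCharHypothesis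
import Summits.ResolutionOfSingularities.ResolutionOfSingularities.Theorems.HilbertSamuelEliminationCampaignW42NearPointRationalBinder
import Literature.AlgebraicGeometry.CossartJannsenSaito2020.NearPointDirectrix
import Literature.AlgebraicGeometry.CossartJannsenSaito2020.DirectrixSemicontinuity
import HarnessLib

/-!
# [OURS · L1 W4.2] ROW (K-ctr-cv) `StrataCurveCentreDominantClean p 3 Q⁎ G⁎` DISCHARGED modulo the printed CJS Thm. 3.14
# (numerical and point-locus renderings) and Thm. 3.6, BY NAME (crux chain w42, kernel (K-ctr), curve-germ case; hand res-D-pv-038)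

OURS (cell `res-hironaka`, slot W4.2, crux `stmt-ResolutionOfSingularities-18506` / conjunct `-19249`; `--supports … --as helper`,
counted 0).  NOT a statement of the manuscript under review [claim: Hironaka2017, status: under-review] nor of [CossartJannsenSaito2020];
AI plumbing, weaker than expert review; every `theorem` is PROVED (conditional on the printed theorems taken as binders BY NAME:
`CossartJannsenSaito2020_thm_3_14` p499700, `Thm314_point_locus`, `CossartJannsenSaito2020_thm_3_6` F-65 p521045), no definition.

## The row (res-L1-w42-stub-4, p522551 l.91) and its proof

Along a never-isolated `ē ≤ 2` chain from a maximal origin in the (F1) regime `QCharRegime p` (`Q⁎ = QNe (QCharRegime p)`), at a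
step `f : X_{n+1} ⟶ X_n` blowing up the canonical centre `C`, for every component `D` of `V(C)` with `x_n ∈ D ≠ {x_n}`: the
components `Z′ ∋ x_{n+1}` of `X_{n+1}(ν)` DOMINATING `D` number at most one and are regular curves at `x_{n+1}`.

* STANDING FACTS (stub-4's `CycleInv`): `V(C)` regular, `V(C) ⊆ X_n(ν)`, `C` permissible; `X_n` excellent of dimension `≤ 3`;
  (F1) at EVERY point of `X_n` (`charHypothesis_of_chain`); `f` is the blow-up in `C`.
* `I(D)_y = C_y` at every `y ∈ D` (`stalkIdeal_vanishingIdeal_eq_of_mem_componentsIn`: `C = 𝓘(V(C))`, the generic point `η` of `D`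
  is a maximal point of `V(C)`, so `𝔭_η` is a minimal prime of the PRIME `C_y`); hence `𝓘(D)` is permissible and
  `𝒪_{X_n,x_n}/I(D)_{x_n} = 𝒪_{X_n,x_n}/C_{x_n}` is regular, of dimension `≥ 1` (`η ≠ x_n`) and `< e_{x_n} ≤ ē ≤ 2` (Thm. 3.14
  numerical at `x_{n+1}`): a DVR.
* `e_η ≤ 1` (Thm. 3.6 at `η ⤳ x_n`: `e_η + dim 𝒪_{D,x_n} ≤ e_{x_n} ≤ 2`), and `e_η ≥ 1` as soon as a dominant member exists (its
  generic point is near to `η`; Thm. 3.14 numerical at it, `C_η = 𝔪_η`): `e_η = 1`.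
* CLAUSE 1: Thm. 3.14 (point locus, after localisation at `η`: res-L1-s42-pv-1's `nearFibre_subsingleton_of_charHypothesis'`) leaves
  at most one point of `X_{n+1}(ν)` over `η`; `dominant_unique_of_fibre_subsingleton` (p522578).
* CLAUSE 2: the near point over `η` is `k(η)`-rational (`isIso_residueFieldMap_of_near_of_charHypothesis`, p522235), so the
  DVR-domination core `isRegularCurveAt_of_dominant_of_isIso_residueFieldMap` (…StrataCentreCurveGerm) applies.

[cite: CossartJannsenSaito2020, Thm. 3.14, Thm. 3.6, Rem. 6.29 (1), p. 104] [cite: StacksProject, Tag 01J7]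
-/

noncomputable section

set_option linter.dupNamespace false -- mandated namespace `…ResolutionOfSingularities.ResolutionOfSingularities…` of this single-conjunct summit

open CategoryTheory AlgebraicGeometry TopologicalSpace Topology IsLocalRing
open Summit.ResolutionOfSingularities.ResolutionOfSingularities.Theorems.CampaignW42
open Literature.AlgebraicGeometry.Resolution Literature.RingTheory.HilbertSamuel
open Literature.AlgebraicGeometry.CossartJannsenSaito2020
open Summit.ResolutionOfSingularities.ResolutionOfSingularities.Theorems.SigmaMaxModificationsCorridor3

universe u

namespace Summit.ResolutionOfSingularities.ResolutionOfSingularities.Theorems.SigmaMaxModificationsCorridor3.Moving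

variable {R : ∀ S : Scheme.{u}, CentreSeq S → Prop} {N : ℕ} {ν : ℕ → ℕ}

/-! ## §1. Components of a regular centre: `I(D)_y = C_y` -/

/-- **The generic point of a component of a closed set is a maximal point of it.** [cite: StacksProject, Tag 01J7] -/
theorem mem_maxPoints_of_isGenericPoint_of_mem_componentsIn {X : Scheme.{u}} {S : Set X} (hS : IsClosed S) {D : Set X}
    (hD : D ∈ componentsIn S) {η : X} (hη : IsGenericPoint η D) : η ∈ maxPoints S := by
  refine ⟨componentsIn.subset hD hη.mem, fun η' hη' hs => ?_⟩
  have hsub : D ⊆ closure {η'} := by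
    rw [← hη.def]
    exact closure_minimal (Set.singleton_subset_iff.mpr (specializes_iff_mem_closure.mp hs)) isClosed_closure
  have heq : closure {η'} = D := ((mem_componentsIn_iff.mp hD).2.2 _
    (closure_minimal (Set.singleton_subset_iff.mpr hη') hS) isIrreducible_singleton.closure hsub).antisymm hsub
  have h1 : IsGenericPoint η' D := by rw [← heq]; exact isGenericPoint_closure
  exact h1.eq hη

/-- **`I(D)_y = C_y`** for a component `D` of the support of a PERMISSIBLE (regular, reduced) centre `C` and `y ∈ D`: `C = 𝓘(V(C))`,
and the prime `𝔭_η` of the generic point `η` of `D` is a minimal prime of the prime `C_y`. [cite: StacksProject, Tag 01J7]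
[cite: CossartJannsenSaito2020, Def. 3.1] -/
theorem stalkIdeal_vanishingIdeal_eq_of_mem_componentsIn {X : Scheme.{u}} [IsLocallyNoetherian X] {C : X.IdealSheafData}
    (hCreg : Scheme.IsRegular C.subscheme) (hCperm : IdealSheafData.IsPermissible C) {D : Set X}
    (hD : D ∈ componentsIn (C.support : Set X)) (hDc : IsClosed D) {y : X} (hy : y ∈ D) :
    stalkIdeal (Scheme.IdealSheafData.vanishingIdeal ⟨D, hDc⟩) y = stalkIdeal C y := by
  have hDirr : IsIrreducible D := componentsIn.isIrreducible hD
  obtain ⟨η, hη⟩ : ∃ η, IsGenericPoint η D := ⟨_, hDirr.isGenericPoint_genericPoint hDc⟩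
  have hηy : η ⤳ y := hη.specializes hy
  have hyC : y ∈ (C.support : Set X) := componentsIn.subset hD hy
  have hDcl : (⟨D, hDc⟩ : Closeds X) = ⟨closure {η}, isClosed_closure⟩ := Closeds.ext hη.def.symm
  rw [hDcl, stalkIdeal_vanishingIdeal_closure hηy]
  haveI : (stalkIdeal C y).IsPrime := isPrime_stalkIdeal_of_isRegular_subscheme hCreg hyC
  have hmin := primeOfSpecializes_mem_minimalPrimes_of_mem_maxPoints (Z := C.support)
    (mem_maxPoints_of_isGenericPoint_of_mem_componentsIn C.support.isClosed hD hη) hηy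
  rw [← eq_vanishingIdeal_support_of_isPermissible hCperm, Ideal.minimalPrimes_eq_subsingleton_self] at hmin
  exact hmin

/-- Hence **`𝓘(D)` is permissible** for a component `D` of a permissible centre. [cite: CossartJannsenSaito2020, Def. 3.1] -/
theorem isPermissible_vanishingIdeal_of_mem_componentsIn {X : Scheme.{u}} [IsLocallyNoetherian X] {C : X.IdealSheafData}
    (hCreg : Scheme.IsRegular C.subscheme) (hCperm : IdealSheafData.IsPermissible C) {D : Set X}
    (hD : D ∈ componentsIn (C.support : Set X)) (hDc : IsClosed D) :
    IdealSheafData.IsPermissible (Scheme.IdealSheafData.vanishingIdeal ⟨D, hDc⟩) := by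
  intro y hy
  have hyD : y ∈ D := by
    rw [← SetLike.mem_coe, Scheme.IdealSheafData.coe_support_vanishingIdeal] at hy; exact hy
  change (stalkIdeal _ y).IsPermissible
  rw [stalkIdeal_vanishingIdeal_eq_of_mem_componentsIn hCreg hCperm hD hDc hyD]
  exact hCperm y (componentsIn.subset hD hyD)

/-! ## §2. The row -/

/-- **ROW (K-ctr-cv) CLOSED MODULO PRINT**: `StrataCurveCentreDominantClean p 3 (QNe (QCharRegime p)) (ē ≤ 2)` from the printed
CJS Thm. 3.14 (numerical `CossartJannsenSaito2020_thm_3_14` and point-locus `Thm314_point_locus` renderings) and Thm. 3.6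
(`CossartJannsenSaito2020_thm_3_6`), by name. [cite: CossartJannsenSaito2020, Thm. 3.14, Thm. 3.6, Rem. 6.29 (1), p. 104] -/
theorem strataCurveCentreDominantClean_of_thm_3_14 {p : ℕ} (h314 : CossartJannsenSaito2020_thm_3_14.{u})
    (h314p : Thm314_point_locus.{u}) (h36 : CossartJannsenSaito2020_thm_3_6.{u}) :
    StrataCurveCentreDominantClean.{u} p 3 (QNe (Helpers.QCharRegime p)) fun s => s.geomDirDim ≤ 2 := by
  intro R hRf hRa ν X _ x hX hQ c h0 hstep hG hnI hmov
  refine ⟨0, fun n _ C P' hcs f hf D hD hxD hDne => ?_⟩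
  obtain ⟨hq, hν⟩ := hQ
  obtain ⟨-, k, _, hinv⟩ := exists_cycleInv_chain' hRf hRa hX h0 hstep
  -- standing facts at stage `n`
  haveI : IsLocallyNoetherian (c n).W := (c n).ln
  haveI : IsLocallyNoetherian (c (n + 1)).W := (c (n + 1)).ln
  haveI : IsNoetherian (c n).W := (hinv n).isNoetherian
  have hexc : Scheme.IsExcellent (c n).W := (hinv n).isExcellent
  have hdimW : topologicalKrullDim (c n).W ≤ ((3 : ℕ) : WithBot ℕ∞) := (hinv n).dim_le
  have hcharAll : ∀ w : (c n).W, CharHypothesis (c n).W w := charHypothesis_of_chain hX hq h0 hstep n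
  obtain ⟨hCreg, hCstr, hCperm, -⟩ := (hinv n).centre hRa hν hcs
  have hptcl : IsClosed ({(c n).pt} : Set (c n).W) := Reaches.isClosed_pt hX.isClosed (reaches_chain h0 hstep n)
  have hptcl' : IsClosed ({(c (n + 1)).pt} : Set (c (n + 1)).W) :=
    Reaches.isClosed_pt hX.isClosed (reaches_chain h0 hstep (n + 1))
  have hptν : (c n).pt ∈ Scheme.hsStratum (c n).W 3 ν := pt_mem_hsStratum_of_reaches hX.mem_stratum (reaches_chain h0 hstep n)
  have hptν' : (c (n + 1)).pt ∈ Scheme.hsStratum (c (n + 1)).W 3 ν :=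
    pt_mem_hsStratum_of_reaches hX.mem_stratum (reaches_chain h0 hstep (n + 1))
  have hWc' : IsClosed (Scheme.hsStratum (c (n + 1)).W 3 ν) := (hinv (n + 1)).isClosed_hsStratum
  have hfpt : f.base (c (n + 1)).pt = (c n).pt := hf.base_pt
  -- `f` is the blow-up in `C`
  have hbl : IsBlowup f C := by
    obtain ⟨C₂, P₂, h₂, x', hcs₂, -, -, -, e, hfe⟩ := hf
    obtain rfl : C₂ = C := hcs₂.centre_unique hRf hcs
    rw [hfe]
    exact (blowup.isBlowup C₂).iso_comp (eqToIso (congrArg MarkedStage.W e))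
  -- `D`: closed irreducible inside `V(C)`, generic point `η ⤳ x_n`, `η ≠ x_n`
  have hCcl : IsClosed (C.support : Set (c n).W) := C.support.isClosed
  have hDc : IsClosed D := componentsIn.isClosed hCcl hD
  have hDirr : IsIrreducible D := componentsIn.isIrreducible hD
  have hDC : D ⊆ (C.support : Set (c n).W) := componentsIn.subset hD
  obtain ⟨η, hη⟩ : ∃ η, IsGenericPoint η D := ⟨_, hDirr.isGenericPoint_genericPoint hDc⟩
  have hηx : η ⤳ (c n).pt := hη.specializes hxD
  have hηC : η ∈ (C.support : Set (c n).W) := hDC hη.mem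
  have hxC : (c n).pt ∈ (C.support : Set (c n).W) := hDC hxD
  have hηne : η ≠ (c n).pt := fun h => hDne (by rw [← hη.def, h, hptcl.closure_eq])
  have hην : Scheme.hsFun (c n).W 3 η = ν := Scheme.mem_hsStratum_iff.mp (hCstr hηC)
  -- `I(D) = C` stalkwise on `D`; `C_η = 𝔪_η`; `𝓘(D)` permissible
  have hIDx : stalkIdeal (Scheme.IdealSheafData.vanishingIdeal ⟨D, hDc⟩) (c n).pt = stalkIdeal C (c n).pt :=
    stalkIdeal_vanishingIdeal_eq_of_mem_componentsIn hCreg hCperm hD hDc hxD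
  have hCη : stalkIdeal C η = maximalIdeal ((c n).W.presheaf.stalk η) := by
    rw [← stalkIdeal_vanishingIdeal_eq_of_mem_componentsIn hCreg hCperm hD hDc hη.mem]
    have hDcl : (⟨D, hDc⟩ : Closeds (c n).W) = ⟨closure {η}, isClosed_closure⟩ := Closeds.ext hη.def.symm
    rw [hDcl, stalkIdeal_vanishingIdeal_closure_self]
  have hDcl : (⟨closure ({η} : Set (c n).W), isClosed_closure⟩ : Closeds (c n).W) = ⟨D, hDc⟩ := Closeds.ext hη.def
  have hpermD : IdealSheafData.IsPermissible (Scheme.IdealSheafData.vanishingIdeal ⟨closure ({η} : Set (c n).W), isClosed_closure⟩) := by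
    rw [hDcl]; exact isPermissible_vanishingIdeal_of_mem_componentsIn hCreg hCperm hD hDc
  -- `A := 𝒪_{x_n}/C_{x_n}` is regular of dimension `1`
  haveI hregA : IsRegularLocalRing ((c n).W.presheaf.stalk (c n).pt ⧸ stalkIdeal C (c n).pt) :=
    isRegularLocalRing_stalk_quotient_stalkIdeal hCreg hxC
  have hge1 : (1 : WithBot ℕ∞) ≤ ringKrullDim ((c n).W.presheaf.stalk (c n).pt ⧸ stalkIdeal C (c n).pt) :=
    one_le_ringKrullDim_quotient_stalkIdeal C hηx hηne hηC
  have he2 : Scheme.dirDim (c n).W (c n).pt ≤ 2 := (Scheme.dirDim_le_geomDirDim (c n).pt).trans (hG n)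
  have hlt : ringKrullDim ((c n).W.presheaf.stalk (c n).pt ⧸ stalkIdeal C (c n).pt) <
      (Scheme.dirDim (c n).W (c n).pt : WithBot ℕ∞) := by
    have hnear : Scheme.hsFun (c (n + 1)).W 3 (c (n + 1)).pt = Scheme.hsFun (c n).W 3 (f.base (c (n + 1)).pt) := by
      rw [Scheme.mem_hsStratum_iff.mp hptν', hfpt, Scheme.mem_hsStratum_iff.mp hptν]
    have h := h314 (c n).W (c (n + 1)).W f C hexc hCperm hbl 3 hdimW (c (n + 1)).pt (hfpt ▸ hxC) (hcharAll _) hnear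
    rw [hfpt] at h
    exact h
  obtain ⟨dA, hdA⟩ := ringKrullDim_eq_nat ((c n).W.presheaf.stalk (c n).pt ⧸ stalkIdeal C (c n).pt)
  have hdimA : ringKrullDim ((c n).W.presheaf.stalk (c n).pt ⧸ stalkIdeal C (c n).pt) = 1 := by
    rw [hdA] at hge1 hlt ⊢
    have h1 : 1 ≤ dA := by exact_mod_cast hge1
    have h2 : dA < Scheme.dirDim (c n).W (c n).pt := by exact_mod_cast hlt
    have : dA = 1 := by omega
    rw [this]; rfl
  -- `e_η ≤ 1` (Thm. 3.6 at `η ⤳ x_n`)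
  have heη1 : Scheme.dirDim (c n).W η ≤ 1 := by
    have h := h36 (c n).W hexc (c n).pt η hηx hpermD
    rw [hDcl, hIDx, hdimA] at h
    have h' : ((Scheme.dirDim (c n).W η + 1 : ℕ) : WithBot ℕ∞) ≤ ((Scheme.dirDim (c n).W (c n).pt : ℕ) : WithBot ℕ∞) := by
      push_cast; exact h
    have h'' : Scheme.dirDim (c n).W η + 1 ≤ Scheme.dirDim (c n).W (c n).pt := by exact_mod_cast h'
    omega
  -- a dominant member: generic point `ζ′ ↦ η`, near to `η`; hence `e_η = 1`
  have member : ∀ Z' ∈ componentsThrough 3 ν (c (n + 1)), closure (f.base '' Z') = D →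
      ∃ ζ', IsGenericPoint ζ' Z' ∧ f.base ζ' = η ∧
        Scheme.hsFun (c (n + 1)).W 3 ζ' = Scheme.hsFun (c n).W 3 (f.base ζ') ∧ Scheme.dirDim (c n).W η = 1 := by
    intro Z' hZ' hdom
    have hZ'c : IsClosed Z' := componentsIn.isClosed hWc' hZ'.1
    have hZ'irr : IsIrreducible Z' := componentsIn.isIrreducible hZ'.1
    obtain ⟨ζ', hζ'⟩ : ∃ ζ', IsGenericPoint ζ' Z' := ⟨_, hZ'irr.isGenericPoint_genericPoint hZ'c⟩
    have hfζ : f.base ζ' = η := (hdom ▸ hζ'.image f.continuous).eq hη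
    have hnear : Scheme.hsFun (c (n + 1)).W 3 ζ' = Scheme.hsFun (c n).W 3 (f.base ζ') := by
      rw [Scheme.mem_hsStratum_iff.mp (componentsIn.subset hZ'.1 hζ'.mem), hfζ, hην]
    refine ⟨ζ', hζ', hfζ, hnear, le_antisymm heη1 ?_⟩
    have h := h314 (c n).W (c (n + 1)).W f C hexc hCperm hbl 3 hdimW ζ' (hfζ ▸ hηC) (hcharAll _) hnear
    rw [hfζ, hCη] at h
    have h0 : ringKrullDim ((c n).W.presheaf.stalk η ⧸ maximalIdeal ((c n).W.presheaf.stalk η)) = 0 := by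
      letI := Ideal.Quotient.field (maximalIdeal ((c n).W.presheaf.stalk η))
      exact ringKrullDim_eq_zero_of_field _
    rw [h0] at h
    have : (0 : ℕ) < Scheme.dirDim (c n).W η := by exact_mod_cast h
    omega
  refine ⟨fun Z' hZ' Z'' hZ'' hd' hd'' => ?_, fun Z' hZ' hdom => ?_⟩
  · -- CLAUSE 1: at most one point of `X_{n+1}(ν)` over `η`
    obtain ⟨-, -, -, -, he1⟩ := member Z' hZ' hd'
    have hsub := nearFibre_subsingleton_of_charHypothesis' h314p (c n).W (c (n + 1)).W f C hexc hCperm hbl 3 hdimW η hηC hCη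
      (hcharAll η) he1
    have hfibη : (Scheme.hsStratum (c (n + 1)).W 3 ν ∩ f.base ⁻¹' {η}).Subsingleton := by
      refine hsub.anti fun z hz => ⟨hz.2, ?_⟩
      rw [Scheme.mem_hsStratum_iff.mp hz.1, hην]
    exact dominant_unique_of_fibre_subsingleton f hη hWc' hfibη hZ'.1 hZ''.1 hd' hd''
  · -- CLAUSE 2: the DVR-domination core at the `k(η)`-rational near point `ζ′`
    obtain ⟨ζ', hζ', hfζ, hnear, he1⟩ := member Z' hZ' hdom
    have hZ'c : IsClosed Z' := componentsIn.isClosed hWc' hZ'.1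
    have hZ'irr : IsIrreducible Z' := componentsIn.isIrreducible hZ'.1
    have hne : Z' ≠ {(c (n + 1)).pt} := by
      intro h
      apply hDne
      rw [← hdom, h, Set.image_singleton, hfpt, hptcl.closure_eq]
    haveI : IsIso (f.residueFieldMap ζ') :=
      isIso_residueFieldMap_of_near_of_charHypothesis h314p (c n).W (c (n + 1)).W f C hexc hCperm hbl 3 hdimW ζ'
        (hfζ ▸ hηC) (by rw [hfζ]; exact hCη) (hcharAll _) (by rw [hfζ]; exact he1) hnear
    have hcl : (⟨closure (f.base '' Z'), isClosed_closure⟩ : Closeds (c n).W) = ⟨D, hDc⟩ := Closeds.ext hdom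
    have hreg' : IsRegularLocalRing ((c n).W.presheaf.stalk (f.base (c (n + 1)).pt) ⧸
        stalkIdeal (Scheme.IdealSheafData.vanishingIdeal ⟨closure (f.base '' Z'), isClosed_closure⟩) (f.base (c (n + 1)).pt)) := by
      rw [hcl, hfpt, hIDx]; exact hregA
    have hdim' : ringKrullDim ((c n).W.presheaf.stalk (f.base (c (n + 1)).pt) ⧸
        stalkIdeal (Scheme.IdealSheafData.vanishingIdeal ⟨closure (f.base '' Z'), isClosed_closure⟩) (f.base (c (n + 1)).pt)) = 1 := by
      rw [hcl, hfpt, hIDx]; exact hdimA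
    exact isRegularCurveAt_of_dominant_of_isIso_residueFieldMap (c (n + 1)) f hptcl' hZ'irr hZ'c hZ'.2 hne hζ' hreg' hdim'

end Summit.ResolutionOfSingularities.ResolutionOfSingularities.Theorems.SigmaMaxModificationsCorridor3.Moving

end
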